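import Summits.AnomalousDissipation.AnomalousDissipation.Theorems.LaminarNeverLoud.Negative.PowerBudget

/-!
# Negative knowledge for the crux `LaminarNeverLoud` (stmt-AnomalousDissipation-2988): II, the laminar Stokes arc of a shear force

Certified copy of §3 of the cdisprove work file `Cruxes/LaminarNeverLoud/Disproof.lean`.  Supports
stmt-AnomalousDissipation-2988.  THE STOKES ARC of the shear (Kolmogorov-type) force `2a cos(2π m x₁)e₀`: the force is
smooth, solenoidal, mean free with Fourier vector `a e₀` at `±(0,m,0)`; the convection symbol of the shear family
vanishes identically (`convectionCoeff_shearCoeff`), so `ν ↦ (a e₀/(4π²νm²) at ±(0,m,0), ν)`, `ν > 0`, is a connected arc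
of zeros of EVERY Galerkin system resolving the two modes (`galerkinRHS_stokesPoint`), reaching `ν → +∞`: every point of
it is LAMINAR in the sense of the crux (`isLaminar_stokesPoint`), with `energy = 2(a/(4π²νm²))²` and
`dissipation = a²/(2π²νm²)` (`energy_stokesPoint`, `dissipation_stokesPoint_eq`).
-/

noncomputable section

-- D-0017: single-problem summit, `Summit.<S>.<S>.…` by design; the Summits library sets
-- `weak.linter.dupNamespace = false`, repeated here for standalone elaboration (`lean check`).
set_option linter.dupNamespace false

namespace Summit.AnomalousDissipation.AnomalousDissipation.Theorems.LaminarNeverLoud.Negative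

open MeasureTheory Set Filter Topology UnitAddTorus
open scoped InnerProductSpace
open Literature.Analysis.FluidPDE Literature.Analysis.FluidPDE.Torus
open Literature.Analysis.FunctionSpaces Literature.Analysis.FunctionSpaces.Torus
-- (the crux decl `Theses.MirrorVariety.LaminarNeverLoud` was dropped from the route file; its verbatim
-- statement is the `@[conjecture] def Negative.LaminarNeverLoud` of the imported PowerBudget module, in scope here)

variable {d : Type*} [Fintype d] [DecidableEq d]

/-! ## §3 The explicit laminar arc of a shear (Kolmogorov) force, and the LOAD-BEARING hypotheses

The force `f = 2a cos(2π m x₁) e₀` (modes `±(0,m,0)`, direction `e₀`) is smooth, solenoidal and mean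
free; its Fourier vector is `a e₀` at `±(0,m,0)`.  Because `e₀ ⊥ (0,m,0)` the convection symbol of ANY
two coefficient families supported on `±(0,m,0)` with values in `ℂ e₀` vanishes identically, so the
STOKES ARC `ν ↦ (a e₀ /(4π²νm²) at ±(0,m,0), ν)`, `ν > 0`, lies on the steady Galerkin variety of EVERY
resolution `N ≥ |m|`; it is connected and reaches `ν → +∞`, hence every point of it is LAMINAR in the
sense of the crux.  Along it `energy = 2 (a/(4π²νm²))²`, `dissipation = a²/(2π²νm²)`: loud for small `ν`,
bounded only for `ν ≳ a/(m²√E)`.  This arc alone certifies which hypotheses of the crux carry load. -/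

section Shear

/-- The shear frequency `(0, m, 0)`. [folklore] -/
def kol (m : ℤ) : Fin 3 → ℤ := Pi.single 1 m

/-- The real unit vector `e₀ ∈ ℂ³`. [folklore] -/
def e0 : EuclideanSpace ℂ (Fin 3) := EuclideanSpace.complexify (EuclideanSpace.single 0 (1 : ℝ))

/-- Print-back notation for THIS file's unit vector `e0 : EuclideanSpace ℂ (Fin 3)` (buildfix 2026-08-20: keeps its
statements visibly distinct from the unrelated real `e0`'s of `Literature.Topology.FourManifolds`). -/
notation "𝐞₀ᶜ" => Summit.AnomalousDissipation.AnomalousDissipation.Theorems.LaminarNeverLoud.Negative.e0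

/-- Coefficient family of the shear field `2a cos(2π m x₁) e₀`: `a e₀` at `±(0,m,0)`, zero elsewhere. [folklore] -/
def shearCoeff (m : ℤ) (a : ℝ) : (Fin 3 → ℤ) → EuclideanSpace ℂ (Fin 3) :=
  fun k => if k = kol m ∨ k = -kol m then (a : ℂ) • e0 else 0

/-- The two shear modes. [folklore] -/
def shearModes (m : ℤ) : Finset (Fin 3 → ℤ) := {kol m, -kol m}

/-- The shear (Kolmogorov-type) force `2a cos(2π m x₁) e₀` on `T³`. [folklore] -/
def shearForce (m : ℤ) (a : ℝ) : UnitAddTorus (Fin 3) → EuclideanSpace ℝ (Fin 3) :=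
  realTrigPoly (shearModes m) (shearCoeff m a)

/-- The shear family restricted to a frequency set `S`. [folklore] -/
def shearVec (S : Finset (Fin 3 → ℤ)) (m : ℤ) (a : ℝ) : ↥S → EuclideanSpace ℂ (Fin 3) :=
  fun k => shearCoeff m a k

/-- The Stokes point of the shear force at viscosity `ν`: amplitude `a/(4π²νm²)`. [folklore] -/
def stokesPoint (S : Finset (Fin 3 → ℤ)) (m : ℤ) (a ν : ℝ) : (↥S → EuclideanSpace ℂ (Fin 3)) × ℝ :=
  (shearVec S m (a / (4 * Real.pi ^ 2 * ν * (m : ℝ) ^ 2)), ν)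

/-- The viscosity coordinate of the Stokes point. [folklore] -/
@[simp] theorem stokesPoint_snd (S : Finset (Fin 3 → ℤ)) (m : ℤ) (a ν : ℝ) : (stokesPoint S m a ν).2 = ν := rfl

/-- Coordinates of the shear frequency. [folklore] -/
theorem kol_apply (m : ℤ) (j : Fin 3) : kol m j = if j = 1 then m else 0 := by
  simp [kol, Pi.single_apply]

/-- The shear frequency is nonzero. [folklore] -/
theorem kol_ne_zero {m : ℤ} (hm : m ≠ 0) : kol m ≠ 0 := by
  intro h
  have := congrFun h 1
  simp [kol_apply] at this
  exact hm this

/-- The two shear modes are distinct. [folklore] -/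
theorem kol_ne_neg {m : ℤ} (hm : m ≠ 0) : kol m ≠ -kol m := by
  intro h
  have := congrFun h 1
  simp only [Pi.neg_apply, kol_apply, if_true] at this
  omega

/-- `|(0,m,0)|² = m²`. [folklore] -/
theorem freqNormSq_kol (m : ℤ) : freqNormSq (kol m) = (m : ℝ) ^ 2 := by
  simp [freqNormSq, kol_apply]

/-- `|k|² = m²` on the shear modes. [folklore] -/
theorem freqNormSq_of_shear {m : ℤ} {k : Fin 3 → ℤ} (hk : k = kol m ∨ k = -kol m) :
    freqNormSq k = (m : ℝ) ^ 2 := by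
  rcases hk with rfl | rfl
  · exact freqNormSq_kol m
  · rw [freqNormSq_neg, freqNormSq_kol]

/-- Off the direction `e₁` the shear modes vanish: `k j = 0` for `j ≠ 1`. [folklore] -/
theorem shear_apply_of_ne_one {m : ℤ} {k : Fin 3 → ℤ} (hk : k = kol m ∨ k = -kol m) {j : Fin 3}
    (hj : j ≠ 1) : k j = 0 := by
  rcases hk with rfl | rfl
  · simp [kol_apply, hj]
  · simp [kol_apply, hj]

/-- Coordinates of `e₀`. [folklore] -/
theorem e0_apply (i : Fin 3) : e0 i = if i = 0 then 1 else 0 := by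
  simp only [e0, EuclideanSpace.complexify_apply, PiLp.single_apply]
  split_ifs <;> simp

/-- `‖e₀‖ = 1`. [folklore] -/
theorem norm_e0 : ‖e0‖ = 1 := by
  rw [e0, EuclideanSpace.norm_complexify, PiLp.norm_single, norm_one]

/-- `e₀` is real. [folklore] -/
theorem conjVec_e0 : EuclideanSpace.conjVec e0 = e0 := EuclideanSpace.conjVec_complexify _

/-- The `e₁`-component of the shear family vanishes. [folklore] -/
theorem shearCoeff_apply_one (m : ℤ) (a : ℝ) (k : Fin 3 → ℤ) : shearCoeff m a k 1 = 0 := by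
  unfold shearCoeff
  split_ifs
  · simp [e0_apply]
  · simp

/-- The shear family on the shear modes. [folklore] -/
theorem shearCoeff_of_shear {m : ℤ} (a : ℝ) {k : Fin 3 → ℤ} (hk : k = kol m ∨ k = -kol m) :
    shearCoeff m a k = (a : ℂ) • e0 := if_pos hk

/-- The shear family off the shear modes. [folklore] -/
theorem shearCoeff_of_not_shear {m : ℤ} (a : ℝ) {k : Fin 3 → ℤ} (hk : ¬(k = kol m ∨ k = -kol m)) :
    shearCoeff m a k = 0 := if_neg hk

/-- Membership in the shear modes. [folklore] -/
theorem mem_shearModes {m : ℤ} {k : Fin 3 → ℤ} : k ∈ shearModes m ↔ k = kol m ∨ k = -kol m := by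
  simp [shearModes]

/-- The shear modes are symmetric. [folklore] -/
theorem shearModes_symm (m : ℤ) : ∀ k ∈ shearModes m, -k ∈ shearModes m := by
  intro k hk
  rw [mem_shearModes] at hk ⊢
  rcases hk with rfl | rfl
  · exact Or.inr rfl
  · exact Or.inl (neg_neg _)

/-- The mean mode is not a shear mode. [folklore] -/
theorem zero_not_mem_shearModes {m : ℤ} (hm : m ≠ 0) : (0 : Fin 3 → ℤ) ∉ shearModes m := by
  rw [mem_shearModes]
  rintro (h | h)
  · exact kol_ne_zero hm h.symm
  · exact kol_ne_zero hm (neg_eq_zero.1 h.symm)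

/-- The shear family is even in `k`. [folklore] -/
theorem shearCoeff_neg (m : ℤ) (a : ℝ) (k : Fin 3 → ℤ) : shearCoeff m a (-k) = shearCoeff m a k := by
  unfold shearCoeff
  have hiff : (-k = kol m ∨ -k = -kol m) ↔ (k = kol m ∨ k = -kol m) := by
    constructor
    · rintro (h | h)
      · exact Or.inr (by rw [← h, neg_neg])
      · exact Or.inl (neg_injective h)
    · rintro (h | h)
      · exact Or.inr (by rw [h])
      · exact Or.inl (by rw [h, neg_neg])
  rw [if_congr hiff rfl rfl]

/-- The shear family is conjugate symmetric (real amplitude, real direction). [folklore] -/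
theorem isConjSymm_shearCoeff (m : ℤ) (a : ℝ) : IsConjSymm (shearCoeff m a) := by
  intro k
  rw [shearCoeff_neg]
  unfold shearCoeff
  split_ifs
  · rw [EuclideanSpace.conjVec_smul, Complex.conj_ofReal, conjVec_e0]
  · rw [EuclideanSpace.conjVec_zero]

/-- The key orthogonality: `∑ⱼ (shearCoeff l)ⱼ k'ⱼ = 0` for every `l` and every shear mode `k'` —
the shear direction `e₀` is perpendicular to the shear wave vector. [folklore] -/
theorem sum_shearCoeff_mul_eq_zero (m : ℤ) (a : ℝ) (l : Fin 3 → ℤ) {k' : Fin 3 → ℤ}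
    (hk' : k' = kol m ∨ k' = -kol m) : ∑ j, shearCoeff m a l j * (k' j : ℂ) = 0 := by
  refine Finset.sum_eq_zero fun j _ => ?_
  by_cases hj : j = 1
  · subst hj; rw [shearCoeff_apply_one, zero_mul]
  · rw [shear_apply_of_ne_one hk' hj, Int.cast_zero, mul_zero]

/-- Transversality of the shear family: `k · shearCoeff k = 0` for every `k`. [folklore] -/
theorem transversal_shearCoeff (m : ℤ) (a : ℝ) (k : Fin 3 → ℤ) :
    ∑ j, (k j : ℂ) * shearCoeff m a k j = 0 := by
  by_cases hk : k = kol m ∨ k = -kol m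
  · simp_rw [mul_comm ((k _ : ℤ) : ℂ)]
    exact sum_shearCoeff_mul_eq_zero m a k hk
  · simp [shearCoeff_of_not_shear a hk]

/-- Transversality of the shear family on any `S`. [folklore] -/
theorem isTransversal_shearCoeff (S : Finset (Fin 3 → ℤ)) (m : ℤ) (a : ℝ) :
    IsTransversal S (shearCoeff m a) := fun k _ => transversal_shearCoeff m a k

/-- **The convection symbol of the shear family vanishes identically** (`(U·∇)U = 0` for a parallel
shear flow, mode by mode and before any projection). [folklore] -/
theorem convectionCoeff_shearCoeff (S : Finset (Fin 3 → ℤ)) (m : ℤ) (a b : ℝ) (k : Fin 3 → ℤ) :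
    convectionCoeff S (shearCoeff m a) (shearCoeff m b) k = 0 := by
  rw [convectionCoeff_def]
  refine Finset.sum_eq_zero fun l _ => Finset.sum_eq_zero fun k' _ => ?_
  split_ifs
  · by_cases hk' : k' = kol m ∨ k' = -kol m
    · rw [sum_shearCoeff_mul_eq_zero m a l hk', mul_zero, zero_smul]
    · rw [shearCoeff_of_not_shear b hk', smul_zero]
  · rfl

/-- The shear force is smooth, [folklore] -/
theorem isSmooth_shearForce (m : ℤ) (a : ℝ) : IsSmooth (shearForce m a) := isSmooth_realTrigPoly _ _

/-- solenoidal, [folklore] -/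
theorem isDivFree_shearForce (m : ℤ) (a : ℝ) : IsDivFree (shearForce m a) :=
  isDivFree_realTrigPoly (isTransversal_shearCoeff _ m a)

/-- and mean free. [folklore] -/
theorem hasZeroMean_shearForce {m : ℤ} (hm : m ≠ 0) (a : ℝ) : HasZeroMean (shearForce m a) :=
  hasZeroMean_realTrigPoly_of_zero_not_mem (zero_not_mem_shearModes hm) _

/-- Its `L²` mass... is not needed below; its Fourier coefficients are the shear family. [folklore] -/
theorem mFourierCoeff_shearForce (m : ℤ) (a : ℝ) (k : Fin 3 → ℤ) :
    mFourierCoeff (EuclideanSpace.complexify ∘ shearForce m a) k = shearCoeff m a k := by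
  rw [shearForce, mFourierCoeff_realTrigPoly (shearModes_symm m) (isConjSymm_shearCoeff m a)]
  split_ifs with hk
  · rfl
  · rw [shearCoeff_of_not_shear a (mt mem_shearModes.2 hk)]

/-- The force vector of the shear force on any `S` is the restricted shear family. [folklore] -/
theorem forceCoeff_shearForce (S : Finset (Fin 3 → ℤ)) (m : ℤ) (a : ℝ) :
    forceCoeff S (shearForce m a) = shearVec S m a :=
  funext fun k => mFourierCoeff_shearForce m a k

variable {S : Finset (Fin 3 → ℤ)} {m : ℤ}

/-- Extension by zero of the restricted family gives the family back (when `S` holds both modes). [folklore] -/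
theorem coeffExt_shearVec (hp : kol m ∈ S) (hn : -kol m ∈ S) (a : ℝ) :
    coeffExt S (shearVec S m a) = shearCoeff m a := by
  funext k
  by_cases hk : k ∈ S
  · rw [coeffExt_of_mem _ hk]; rfl
  · rw [coeffExt_of_not_mem _ hk, shearCoeff_of_not_shear]
    rintro (rfl | rfl)
    · exact hk hp
    · exact hk hn

/-- The restricted shear family lies in the Galerkin phase space. [folklore] -/
theorem shearVec_mem (m : ℤ) (a : ℝ) : shearVec S m a ∈ galerkinSubspace S := by
  refine ⟨fun k l hkl => ?_, fun k => transversal_shearCoeff m a k⟩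
  show shearCoeff m a l = EuclideanSpace.conjVec (shearCoeff m a k)
  rw [hkl]
  exact isConjSymm_shearCoeff m a k

/-- **THE STOKES ARC SOLVES EVERY GALERKIN SYSTEM**: for `ν ≠ 0`, `m ≠ 0` and `±(0,m,0) ∈ S`,
`galerkinRHS S ν (shear force) (shear/(4π²νm²)) = 0`. [folklore] -/
theorem galerkinRHS_stokesPoint (hp : kol m ∈ S) (hn : -kol m ∈ S) (hm : m ≠ 0) (a : ℝ) {ν : ℝ}
    (hν : ν ≠ 0) :
    galerkinRHS S ν (shearVec S m a) (stokesPoint S m a ν).1 = 0 := by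
  funext k
  rw [stokesPoint, galerkinRHS_apply, galerkinField_def, coeffExt_shearVec hp hn,
    coeffExt_shearVec hp hn, convectionCoeff_shearCoeff, sub_zero,
    leraySym_of_transversal (transversal_shearCoeff m a _), Pi.zero_apply]
  by_cases hk : (k : Fin 3 → ℤ) = kol m ∨ (k : Fin 3 → ℤ) = -kol m
  · rw [shearCoeff_of_shear _ hk, shearCoeff_of_shear _ hk, freqNormSq_of_shear hk, smul_smul,
      ← neg_smul, ← add_smul]
    have hm' : (m : ℝ) ≠ 0 := Int.cast_ne_zero.2 hm
    have hreal : -(ν * (4 * Real.pi ^ 2 * (m : ℝ) ^ 2) * (a / (4 * Real.pi ^ 2 * ν * (m : ℝ) ^ 2))) + a = 0 := by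
      field_simp
      ring
    have hc : (-((((ν * (4 * Real.pi ^ 2 * (m : ℝ) ^ 2)) : ℝ) : ℂ) *
        (((a / (4 * Real.pi ^ 2 * ν * (m : ℝ) ^ 2)) : ℝ) : ℂ)) + (a : ℂ)) = 0 := by
      exact_mod_cast hreal
    rw [hc, zero_smul]
  · rw [shearCoeff_of_not_shear _ hk, shearCoeff_of_not_shear _ hk, smul_zero, neg_zero, add_zero]

/-- The Stokes point lies on the steady Galerkin variety of the shear force. [folklore] -/
theorem stokesPoint_mem (hp : kol m ∈ S) (hn : -kol m ∈ S) (hm : m ≠ 0) (a : ℝ) {ν : ℝ} (hν : ν ≠ 0) :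
    stokesPoint S m a ν ∈ steadySet S (shearVec S m a) :=
  ⟨shearVec_mem m _, galerkinRHS_stokesPoint hp hn hm a hν⟩

/-- A sum over `↥S` of a function of the shear family reduces to the two shear modes. [folklore] -/
theorem sum_shear (hp : kol m ∈ S) (hn : -kol m ∈ S) (hm : m ≠ 0) (F : (Fin 3 → ℤ) → EuclideanSpace ℂ (Fin 3) → ℝ)
    (hF : ∀ k, F k 0 = 0) (a : ℝ) :
    ∑ k : ↥S, F k (shearCoeff m a k) = F (kol m) ((a : ℂ) • e0) + F (-kol m) ((a : ℂ) • e0) := by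
  rw [Finset.sum_coe_sort S (fun k => F k (shearCoeff m a k))]
  have hsub : shearModes m ⊆ S := by
    intro k hk
    rcases mem_shearModes.1 hk with rfl | rfl
    · exact hp
    · exact hn
  rw [← Finset.sum_subset hsub (fun k _ hk => by
    rw [shearCoeff_of_not_shear a (mt mem_shearModes.2 hk), hF]), shearModes,
    Finset.sum_pair (kol_ne_neg hm), shearCoeff_of_shear a (Or.inl rfl),
    shearCoeff_of_shear a (Or.inr rfl)]

/-- `‖a e₀‖² = a²`. [folklore] -/
theorem norm_smul_e0_sq (a : ℝ) : ‖(a : ℂ) • e0‖ ^ 2 = a ^ 2 := by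
  rw [norm_smul, norm_e0, mul_one, Complex.norm_real, Real.norm_eq_abs, sq_abs]

/-- Energy of the restricted shear family: `2a²`. [folklore] -/
theorem energy_shearVec (hp : kol m ∈ S) (hn : -kol m ∈ S) (hm : m ≠ 0) (a : ℝ) :
    energy (shearVec S m a) = 2 * a ^ 2 := by
  unfold energy shearVec
  rw [sum_shear hp hn hm (fun _ v => ‖v‖ ^ 2) (fun _ => by simp) a, norm_smul_e0_sq]
  ring

/-- Enstrophy sum of the restricted shear family: `2m²a²`. [folklore] -/
theorem enstrophySum_shearVec (hp : kol m ∈ S) (hn : -kol m ∈ S) (hm : m ≠ 0) (a : ℝ) :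
    ∑ k : ↥S, freqNormSq (k : Fin 3 → ℤ) * ‖shearVec S m a k‖ ^ 2 = 2 * (m : ℝ) ^ 2 * a ^ 2 := by
  unfold shearVec
  rw [sum_shear hp hn hm (fun k v => freqNormSq k * ‖v‖ ^ 2) (fun _ => by simp) a, norm_smul_e0_sq,
    freqNormSq_kol, freqNormSq_neg, freqNormSq_kol]
  ring

/-- **Energy along the Stokes arc**: `2 (a/(4π²νm²))²` (`= a²/(8π⁴ν²m⁴)`). [folklore] -/
theorem energy_stokesPoint (hp : kol m ∈ S) (hn : -kol m ∈ S) (hm : m ≠ 0) (a ν : ℝ) :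
    energy (stokesPoint S m a ν).1 = 2 * (a / (4 * Real.pi ^ 2 * ν * (m : ℝ) ^ 2)) ^ 2 :=
  energy_shearVec hp hn hm _

/-- **Dissipation along the Stokes arc**: `ν 4π² · 2m² (a/(4π²νm²))²` (`= a²/(2π²νm²)`). [folklore] -/
theorem dissipation_stokesPoint (hp : kol m ∈ S) (hn : -kol m ∈ S) (hm : m ≠ 0) (a ν : ℝ) :
    dissipation ν (stokesPoint S m a ν).1 =
      ν * (4 * Real.pi ^ 2 * (2 * (m : ℝ) ^ 2 * (a / (4 * Real.pi ^ 2 * ν * (m : ℝ) ^ 2)) ^ 2)) := by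
  unfold dissipation
  rw [stokesPoint, enstrophySum_shearVec hp hn hm]

/-- The same in closed form: `dissipation = a²/(2π²νm²)` for `ν ≠ 0`. [folklore] -/
theorem dissipation_stokesPoint_eq (hp : kol m ∈ S) (hn : -kol m ∈ S) (hm : m ≠ 0) (a : ℝ) {ν : ℝ}
    (hν : ν ≠ 0) :
    dissipation ν (stokesPoint S m a ν).1 = a ^ 2 / (2 * Real.pi ^ 2 * ν * (m : ℝ) ^ 2) := by
  rw [dissipation_stokesPoint hp hn hm]
  have hm' : (m : ℝ) ≠ 0 := Int.cast_ne_zero.2 hm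
  field_simp
  ring

/-- The restricted shear family is linear in the amplitude. [folklore] -/
theorem shearVec_eq_smul (S : Finset (Fin 3 → ℤ)) (m : ℤ) (a : ℝ) :
    shearVec S m a = (a : ℂ) • shearVec S m 1 := by
  funext k
  show shearCoeff m a k = (a : ℂ) • shearCoeff m 1 k
  unfold shearCoeff
  split_ifs
  · rw [smul_smul, Complex.ofReal_one, mul_one]
  · rw [smul_zero]

/-- The Stokes arc is continuous on `ν > 0`. [folklore] -/
theorem continuousOn_stokesPoint (S : Finset (Fin 3 → ℤ)) (hm : m ≠ 0) (a : ℝ) :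
    ContinuousOn (fun ν : ℝ => stokesPoint S m a ν) (Ioi 0) := by
  have h1 : ContinuousOn (fun ν : ℝ => a / (4 * Real.pi ^ 2 * ν * (m : ℝ) ^ 2)) (Ioi 0) := by
    refine continuousOn_const.div (by fun_prop) fun ν hν => ?_
    have hm' : (m : ℝ) ≠ 0 := Int.cast_ne_zero.2 hm
    have hν' : (ν : ℝ) ≠ 0 := ne_of_gt hν
    positivity
  have h2 : ContinuousOn (fun ν : ℝ => (((a / (4 * Real.pi ^ 2 * ν * (m : ℝ) ^ 2)) : ℝ) : ℂ) •
      shearVec S m 1) (Ioi 0) :=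
    (Complex.continuous_ofReal.comp_continuousOn h1).smul continuousOn_const
  have h3 : (fun ν : ℝ => stokesPoint S m a ν) =
      fun ν => ((((a / (4 * Real.pi ^ 2 * ν * (m : ℝ) ^ 2)) : ℝ) : ℂ) • shearVec S m 1, ν) := by
    funext ν
    rw [stokesPoint, shearVec_eq_smul]
  rw [h3]
  exact h2.prodMk continuousOn_id

/-- **EVERY STOKES POINT IS LAMINAR**: the arc `{stokesPoint μ | μ > 0}` is a connected subset of the
variety through the point and reaches arbitrarily large viscosity. [folklore] -/
theorem isLaminar_stokesPoint (hp : kol m ∈ S) (hn : -kol m ∈ S) (hm : m ≠ 0) (a : ℝ) {ν : ℝ}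
    (hν : 0 < ν) : stokesPoint S m a ν ∈ laminarSet (steadySet S (shearVec S m a)) := by
  intro Λ
  set γ : ℝ → (↥S → EuclideanSpace ℂ (Fin 3)) × ℝ := fun μ => stokesPoint S m a μ with hγ
  have hconn : IsPreconnected (γ '' Ioi 0) :=
    isPreconnected_Ioi.image γ (continuousOn_stokesPoint S hm a)
  have hsub : γ '' Ioi 0 ⊆ steadySet S (shearVec S m a) := by
    rintro _ ⟨μ, hμ, rfl⟩
    exact stokesPoint_mem hp hn hm a (ne_of_gt hμ)
  have hmem : stokesPoint S m a ν ∈ γ '' Ioi 0 := ⟨ν, hν, rfl⟩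
  have hcomp := hconn.subset_connectedComponentIn hmem hsub
  refine ⟨γ (max Λ 1), hcomp ⟨max Λ 1, Set.mem_Ioi.2 (lt_of_lt_of_le one_pos (le_max_right Λ 1)), rfl⟩, ?_⟩
  show Λ ≤ max Λ 1
  exact le_max_left _ _

/-- `(0,m,0)` is resolved at resolution `N ≥ |m|`; in particular at `N = m.natAbs`. [folklore] -/
theorem kol_mem_modes {m : ℤ} (hm : m ≠ 0) {N : ℕ} (hN : m.natAbs ≤ N) : kol m ∈ modes (Fin 3) N := by
  refine Finset.mem_erase.2 ⟨kol_ne_zero hm, mem_freqBall.2 ?_⟩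
  rw [freqNormSq_kol]
  have h : |(m : ℝ)| ≤ (N : ℝ) := by
    rw [← Int.cast_abs]; exact_mod_cast (Int.abs_eq_natAbs m ▸ (Int.ofNat_le.2 hN))
  calc (m : ℝ) ^ 2 = |(m : ℝ)| ^ 2 := (sq_abs _).symm
    _ ≤ (N : ℝ) ^ 2 := pow_le_pow_left₀ (abs_nonneg _) h 2

/-- `-(0,m,0)` is resolved at resolution `N ≥ |m|`. [folklore] -/
theorem neg_kol_mem_modes {m : ℤ} (hm : m ≠ 0) {N : ℕ} (hN : m.natAbs ≤ N) : -kol m ∈ modes (Fin 3) N :=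
  modes_symm N _ (kol_mem_modes hm hN)

end Shear

end Summit.AnomalousDissipation.AnomalousDissipation.Theorems.LaminarNeverLoud.Negative
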